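import Literature.AlgebraicGeometry.RelativeSpec.SubringSpecStalks
import Literature.AlgebraicGeometry.RelativeSpec.FiniteGroupQuotientGenericEtale
import Mathlib.AlgebraicGeometry.FunctionField
import HarnessLib

/-!
# The relative spectrum of `𝒪_X ∩ M` for a subfield `M` of the function field

Let `X` be an integral scheme with generic point `ξ` and function field `L = 𝒪_{X,ξ}`, let
`f : X ⟶ Y` be quasi-compact quasi-separated, and let `M ⊆ L` be a subfield. The sections of `X`
over `f⁻¹U` **whose germ at `ξ` lies in `M`** form subrings `Γ(X, f⁻¹U) ∩ M` (`germRing`),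
stable under restriction and quasi-coherent over `Y` (over an affine `U`, `Γ(X, f⁻¹D(r)) ∩ M` is
the localisation of `Γ(X, f⁻¹U) ∩ M` at `r`, because `M` is a field). As soon as the sections
coming from `Y` have germs in `M` they form a subring datum `germDatum f M` in the sense of
`Literature.AlgebraicGeometry.RelativeSpec.SubringSpec`, whence the relative spectrum
`Z = Spec_Y(f_*𝒪_X ∩ M)` with `u = toSpec : X → Z` dominant and `Z` integral. This is the
construction of the **models of intermediate fields** `K(Y) ⊆ M ⊆ K(X)` used for the
infinitesimal (purely inseparable) quotients of de Jong's Galois alterations (de Jong 1997, 5.3;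
for `M = L^G` it is the quotient by the finite group `G`, Mumford AV §7).

* `germRing M U`, `mem_germRing_iff`; `germDatum f M happ : SubringDatum f`,
  `mem_germDatum_ring_iff`;
* `germ_app_mem_of_fromSpecStalk_comp_eq` — the hypothesis `happ` (germs of `f^*`-sections lie
  in `M`) holds as soon as `Spec L → X → Y` factors through `Spec L → Spec M`;
* `isIntegrallyClosed_germRing` — `Γ(X, U) ∩ M` is integrally closed when `Γ(X, U)` is (`U`
  affine), whence `isIntegrallyClosed_stalk_germDatum`: `Z` is normal when `X` is;
* `functionFieldMap_toSpec_mem` (`u^* K(Z) ⊆ M`) and `div_mem_range_functionFieldMap_toSpec`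
  (quotients of germs of sections of `Γ(X, f⁻¹U) ∩ M` lie in `u^* K(Z)`), the two halves of
  "`K(Z) = M`" modulo generation of `M`.

## References

* A. J. de Jong, *Families of curves and alterations*, Ann. Inst. Fourier 47 (1997), 5.3.
  [DeJong1997]
* [StacksProject, Tag 01LQ] (relative spectrum). [MumfordAV1970] §7 (the case `M = L^G`).

## Design

Membership is `∀ h : ξ ∈ f⁻¹U, germ s ∈ M` (vacuous over the empty open, where the ring of
sections is trivial), avoiding `Nonempty` instances. Everything is proved; the two `def`s are
constructions with bodies; no named facts.
-/

noncomputable section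

universe u

open CategoryTheory Limits AlgebraicGeometry
open Literature.AlgebraicGeometry.Motives Literature.AlgebraicGeometry.Motives.RatFn

namespace Literature.AlgebraicGeometry.RelativeSpec

variable {X : Scheme.{u}} [IsIntegral X]

/-! ### Sections whose generic germ lies in a subfield -/

/-- **`Γ(X, U) ∩ M`**: the subring of sections of the integral scheme `X` over `U` whose germ at
the generic point lies in the subfield `M` of the function field (all sections if `U = ∅`).
[folklore] -/
def germRing (M : Subfield X.functionField) (U : X.Opens) : Subring Γ(X, U) where
  carrier := {s | ∀ h : genericPoint X ∈ U, X.presheaf.germ U (genericPoint X) h s ∈ M}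
  mul_mem' {a b} ha hb h := by rw [map_mul]; exact M.mul_mem (ha h) (hb h)
  one_mem' h := by rw [map_one]; exact M.one_mem
  add_mem' {a b} ha hb h := by rw [map_add]; exact M.add_mem (ha h) (hb h)
  zero_mem' h := by rw [map_zero]; exact M.zero_mem
  neg_mem' {a} ha h := by rw [map_neg]; exact M.neg_mem (ha h)

/-- Membership in `Γ(X, U) ∩ M`. [folklore] -/
theorem mem_germRing_iff (M : Subfield X.functionField) (U : X.Opens) (s : Γ(X, U)) :
    s ∈ germRing M U ↔ ∀ h : genericPoint X ∈ U, X.presheaf.germ U (genericPoint X) h s ∈ M :=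
  Iff.rfl

omit [IsIntegral X] in
/-- An open of an irreducible scheme not containing the generic point is empty. [folklore] -/
theorem eq_bot_of_genericPoint_not_mem [IrreducibleSpace X] {U : X.Opens}
    (h : genericPoint X ∉ U) : U = ⊥ := by
  rw [eq_bot_iff]
  intro y hy
  exact (h (((genericPoint_spec X).specializes (Set.mem_univ y)).mem_open U.2 hy)).elim

omit [IsIntegral X] in
/-- The ring of sections over an open not containing the generic point is trivial. [folklore] -/
theorem subsingleton_sections_of_genericPoint_not_mem [IrreducibleSpace X] {U : X.Opens}
    (h : genericPoint X ∉ U) : Subsingleton Γ(X, U) :=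
  CommRingCat.subsingleton_of_isTerminal (X.sheaf.isTerminalOfEqEmpty (eq_bot_of_genericPoint_not_mem h))

/-! ### The subring datum `U ↦ Γ(X, f⁻¹U) ∩ M` -/

variable {Y : Scheme.{u}} (f : X ⟶ Y) [QuasiCompact f] [QuasiSeparated f]
  (M : Subfield X.functionField)

set_option backward.isDefEq.respectTransparency false in
/-- **The subring datum `U ↦ Γ(X, f⁻¹U) ∩ M`** of a subfield `M` of the function field of the
integral `X`, for `f : X ⟶ Y` qcqs such that the sections coming from `Y` have germs in `M`
(`happ`). Quasi-coherence: over an affine `U`, an element `x = s / f^*(r)ⁿ` of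
`Γ(X, f⁻¹D(r)) = Γ(X, f⁻¹U)[1/f^*r]` has germ in `M` iff `s` does, as the germ of `f^*(r)` is a
nonzero element of the field `M`. Its relative spectrum is the model of `M` between `X` and `Y`
(de Jong 1997, 5.3, the infinitesimal quotients; Mumford AV §7 for `M = L^G`). [folklore] -/
def germDatum (happ : ∀ (U : Y.Opens) (a : Γ(Y, U)) (h : genericPoint X ∈ f ⁻¹ᵁ U),
    X.presheaf.germ (f ⁻¹ᵁ U) (genericPoint X) h (f.app U a) ∈ M) : SubringDatum f where
  ring U := germRing M (f ⁻¹ᵁ U)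
  map_mem {U V} i x hx h := by
    rw [TopCat.Presheaf.germ_res_apply X.presheaf]
    exact hx _
  app_mem U a := happ U a
  mem_basicOpen_iff {U} hU r x := by
    by_cases hξ : genericPoint X ∈ f ⁻¹ᵁ Y.basicOpen r
    swap
    · haveI := subsingleton_sections_of_genericPoint_not_mem hξ
      refine iff_of_true (fun h ↦ (hξ h).elim) ⟨0, 0, Subring.zero_mem _, Subsingleton.elim _ _⟩
    have hξU : genericPoint X ∈ f ⁻¹ᵁ U := f.preimage_mono (Y.basicOpen_le r) hξ
    -- the germ of `f^* r` is a nonzero element of `M`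
    have hgM : X.presheaf.germ _ _ hξU (f.app U r) ∈ M := happ U r hξU
    have hg0 : X.presheaf.germ _ _ hξU (f.app U r) ≠ 0 := by
      have hξ' : genericPoint X ∈ X.basicOpen (f.app U r) := by
        rw [← Scheme.Hom.preimage_basicOpen]; exact hξ
      exact ((X.mem_basicOpen (f.app U r) _ hξU).mp hξ').ne_zero
    have hres : ∀ s : Γ(X, f ⁻¹ᵁ U), X.presheaf.germ _ _ hξ
        (X.presheaf.map (homOfLE (f.preimage_mono (Y.basicOpen_le r))).op s) =
        X.presheaf.germ _ _ hξU s := fun s ↦ TopCat.Presheaf.germ_res_apply X.presheaf _ _ _ _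
    constructor
    · intro hx
      -- `Γ(X, f⁻¹D(r))` is the localisation of `Γ(X, f⁻¹U)` at `f^* r`
      let inst : Algebra Γ(X, f ⁻¹ᵁ U) Γ(X, f ⁻¹ᵁ Y.basicOpen r) :=
        (X.presheaf.map (homOfLE (f.preimage_mono (Y.basicOpen_le r))).op).hom.toAlgebra
      have : IsLocalization.Away (f.app U r) Γ(X, f ⁻¹ᵁ Y.basicOpen r) := by
        let : Algebra Γ(X, f ⁻¹ᵁ U) Γ(X, X.basicOpen (f.app _ r)) :=
          (X.presheaf.map (homOfLE (X.basicOpen_le _)).op).hom.toAlgebra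
        dsimp +instances [inst]
        rw! (castMode := .all) [f.preimage_basicOpen r]
        exact isLocalization_basicOpen_of_qcqs (f.isCompact_preimage hU.isCompact)
            (f.isQuasiSeparated_preimage hU.isQuasiSeparated) (f.app _ r)
      obtain ⟨⟨a, ⟨_, m, rfl⟩⟩, ha⟩ := IsLocalization.surj (Submonoid.powers (f.app U r)) x
      simp only [RingHom.algebraMap_toAlgebra, map_pow] at ha
      refine ⟨m, a, fun h ↦ ?_, ?_⟩
      · have e := congrArg (X.presheaf.germ _ _ hξ) ha
        simp only [map_mul, map_pow, hres] at e
        rw [← e]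
        exact M.mul_mem (hx hξ) (M.pow_mem hgM m)
      · rw [mul_comm]; exact ha
    · rintro ⟨n, s, hs, e⟩ h
      have e' := congrArg (X.presheaf.germ _ _ hξ) e
      simp only [map_mul, map_pow, hres] at e'
      have hx : X.presheaf.germ _ _ hξ x =
          X.presheaf.germ _ _ hξU s * ((X.presheaf.germ _ _ hξU (f.app U r)) ^ n)⁻¹ := by
        rw [← e', mul_comm (_ ^ n), mul_assoc, mul_inv_cancel₀ (pow_ne_zero n hg0), mul_one]
      rw [hx]
      exact M.mul_mem (hs hξU) (M.inv_mem (M.pow_mem hgM n))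

variable {f M}

/-- Membership in the rings of `germDatum`: the germ at the generic point lies in `M`.
[folklore] -/
@[simp]
theorem mem_germDatum_ring_iff (happ) (U : Y.Opens) (s : Γ(X, f ⁻¹ᵁ U)) :
    s ∈ (germDatum f M happ).ring U ↔
      ∀ h : genericPoint X ∈ f ⁻¹ᵁ U, X.presheaf.germ (f ⁻¹ᵁ U) (genericPoint X) h s ∈ M :=
  Iff.rfl

/-! ### The hypothesis: sections from `Y` have germs in `M` -/

omit [IsIntegral X] in
/-- The inclusion of a subfield is a local homomorphism (units are the nonzero elements on both
sides). [folklore] -/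
theorem isLocalHom_subtype {L : Type*} [Field L] (M : Subfield L) : IsLocalHom M.subtype := by
  refine ⟨fun a ha ↦ ?_⟩
  have : (a : L) ≠ 0 := ha.ne_zero
  exact isUnit_iff_ne_zero.mpr fun h ↦ this (by rw [h]; rfl)

omit [QuasiCompact f] [QuasiSeparated f] in
/-- **Germs of `f^*`-sections lie in `M` when `Spec K(X) → Y` factors through `Spec M`.** If
`Spec 𝒪_{X,ξ} → X → Y` equals `Spec 𝒪_{X,ξ} → Spec M → Y` for some `m : Spec M → Y`, then for
every section `a` of `Y` the germ at `ξ` of `f^* a` lies in `M` (it is the image under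
`𝒪_{Y, f ξ} → M → 𝒪_{X,ξ}` of the germ of `a`; Mathlib `stalkClosedPointTo`). [folklore] -/
theorem germ_app_mem_of_fromSpecStalk_comp_eq (m : Spec (CommRingCat.of M) ⟶ Y)
    (hm : X.fromSpecStalk (genericPoint X) ≫ f = Spec.map (CommRingCat.ofHom M.subtype) ≫ m)
    (U : Y.Opens) (a : Γ(Y, U)) (h : genericPoint X ∈ f ⁻¹ᵁ U) :
    X.presheaf.germ (f ⁻¹ᵁ U) (genericPoint X) h (f.app U a) ∈ M := by
  haveI := isLocalHom_subtype M
  set L : CommRingCat := X.presheaf.stalk (genericPoint X) with hL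
  set ι : CommRingCat.of M ⟶ L := CommRingCat.ofHom M.subtype with hι
  haveI : IsLocalHom ι.hom := isLocalHom_subtype M
  -- every morphism `Spec L → Y` through `Spec M` has `stalkClosedPointTo` valued in `M`
  have key : ∀ (F₀ : Spec L ⟶ Y), F₀ = Spec.map ι ≫ m →
      ∀ (W : Y.Opens) (hW : F₀ (IsLocalRing.closedPoint L) ∈ W) (t : Γ(Y, W)),
        (Scheme.stalkClosedPointTo F₀ (Y.presheaf.germ W _ hW t) : L) ∈ M := by
    rintro _ rfl W hW t
    rw [Scheme.stalkClosedPointTo_comp]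
    change Scheme.stalkClosedPointTo (Spec.map ι) (m.stalkMap ((Spec.map ι) (IsLocalRing.closedPoint L))
      (Y.presheaf.germ W _ hW t)) ∈ M
    generalize m.stalkMap ((Spec.map ι) (IsLocalRing.closedPoint L)) (Y.presheaf.germ W _ hW t) = e
    obtain ⟨V, hV, s, rfl⟩ := TopCat.Presheaf.exists_germ_eq (Spec (CommRingCat.of M)).presheaf e
    have hV' : IsLocalRing.closedPoint (CommRingCat.of M) ∈ V := by
      rwa [Spec_closedPoint] at hV
    obtain rfl : V = ⊤ := IsLocalRing.closed_point_mem_iff.mp hV'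
    rw [← CommRingCat.comp_apply, Scheme.germ_stalkClosedPointTo_Spec ι]
    exact ((Scheme.ΓSpecIso (CommRingCat.of M)).hom s).2
  -- apply it to `Spec L → Spec 𝒪_{Y, f ξ} → Y`
  let ψ := f.stalkMap (genericPoint X)
  have E : Spec.map ψ ≫ Y.fromSpecStalk (f (genericPoint X)) = Spec.map ι ≫ m := by
    rw [Scheme.SpecMap_stalkMap_fromSpecStalk, hm]
    rfl
  have hpt : (Spec.map ψ ≫ Y.fromSpecStalk (f (genericPoint X))) (IsLocalRing.closedPoint L) ∈ U := by
    rw [Scheme.Hom.comp_apply, Spec_closedPoint, Scheme.fromSpecStalk_closedPoint]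
    exact h
  have h1 := key _ E U hpt a
  have h2 := congrArg (fun φ ↦ φ a)
    (Scheme.germ_stalkClosedPointTo_Spec_fromSpecStalk ψ U hpt)
  simp only [CommRingCat.comp_apply] at h2
  rw [h2] at h1
  change ψ (Y.presheaf.germ U (f (genericPoint X)) h a) ∈ M at h1
  rwa [Scheme.Hom.germ_stalkMap_apply] at h1

/-! ### Normality of the rings `Γ(X, U) ∩ M` -/

/-- **`Γ(X, U) ∩ M` is integrally closed when `Γ(X, U)` is** (`U` affine nonempty): an element
of its fraction field integral over it is integral over `Γ(X, U)`, so lies in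
`Γ(X, U) ⊆ K(X)`, and lies in the field `M`. [folklore] -/
theorem isIntegrallyClosed_germRing (M : Subfield X.functionField) {U : X.Opens}
    (hU : IsAffineOpen U) [Nonempty U] [IsIntegrallyClosed Γ(X, U)] :
    IsIntegrallyClosed (germRing M U) := by
  classical
  haveI := functionField_isFractionRing_of_isAffineOpen X U hU
  have hξ : genericPoint X ∈ U := by
    obtain ⟨⟨y, hy⟩⟩ := ‹Nonempty U›
    exact ((genericPoint_spec X).specializes (Set.mem_univ y)).mem_open U.2 hy
  set B := germRing M U
  let A : Type u := Γ(X, U)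
  let L : Type u := X.functionField
  letI algBA : Algebra B A := B.subtype.toAlgebra
  letI algBL : Algebra B L := ((algebraMap A L).comp B.subtype).toAlgebra
  haveI : IsScalarTower B A L := IsScalarTower.of_algebraMap_eq fun _ ↦ rfl
  have halg : ∀ b : B, algebraMap B L b = X.presheaf.germ U _ hξ (b : A) := fun _ ↦ rfl
  have hinj : Function.Injective (Algebra.ofId B L) :=
    (IsFractionRing.injective A L).comp Subtype.val_injective
  let K := FractionRing B
  let j : K →ₐ[B] L := IsFractionRing.liftAlgHom hinj
  rw [isIntegrallyClosed_iff K]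
  intro x hx
  -- `j x` is integral over `A`, hence comes from some `a : A`
  have h1 : IsIntegral A (j x) := (hx.map j).tower_top
  obtain ⟨a, ha⟩ := (isIntegrallyClosed_iff L).mp ‹IsIntegrallyClosed A› h1
  -- `j x ∈ M`
  have hjM : j x ∈ M := by
    obtain ⟨b₁, b₂, -, rfl⟩ := IsFractionRing.div_surjective (A := B) x
    rw [map_div₀]
    change IsFractionRing.lift hinj _ / IsFractionRing.lift hinj _ ∈ M
    rw [IsFractionRing.lift_algebraMap, IsFractionRing.lift_algebraMap]
    exact M.div_mem (b₁.2 hξ) (b₂.2 hξ)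
  have haB : a ∈ B := by
    intro h'
    have : X.presheaf.germ U _ h' a = algebraMap A L a := rfl
    rw [this, ha]
    exact hjM
  refine ⟨⟨a, haB⟩, j.toRingHom.injective ?_⟩
  change IsFractionRing.lift hinj (algebraMap B K ⟨a, haB⟩) = j x
  rw [IsFractionRing.lift_algebraMap]
  exact ha

/-- **`Spec_Y(f_*𝒪_X ∩ M)` is normal** when the rings `Γ(X, f⁻¹U)`, `U ⊆ Y` affine with `f⁻¹U`
nonempty, are integrally closed and `f` is affine (so that the `f⁻¹U` are affine): its local
rings are localisations of the integrally closed domains `Γ(X, f⁻¹U) ∩ M`. [folklore] -/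
theorem isIntegrallyClosed_stalk_germDatum [IsAffineHom f] (happ)
    (hX : ∀ U : Y.affineOpens, Nonempty (f ⁻¹ᵁ U.1 : X.Opens) → IsIntegrallyClosed Γ(X, f ⁻¹ᵁ U.1))
    (z : (germDatum f M happ).spec) : IsIntegrallyClosed ((germDatum f M happ).spec.presheaf.stalk z) := by
  refine (germDatum f M happ).isIntegrallyClosed_stalk (fun U hnt ↦ ?_) z
  change Nontrivial (germRing M (f ⁻¹ᵁ U.1)) at hnt
  haveI : Nonempty (f ⁻¹ᵁ U.1 : X.Opens) := by
    by_contra hne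
    have hξ : genericPoint X ∉ f ⁻¹ᵁ U.1 := fun h ↦ hne ⟨⟨_, h⟩⟩
    haveI := subsingleton_sections_of_genericPoint_not_mem hξ
    exact not_nontrivial (germRing M (f ⁻¹ᵁ U.1)) hnt
  haveI := hX U ‹_›
  exact ⟨inferInstance, isIntegrallyClosed_germRing M (U.2.preimage f)⟩

/-! ### The function field of `Spec_Y(f_*𝒪_X ∩ M)` -/

section FunctionField

variable (happ : ∀ (U : Y.Opens) (a : Γ(Y, U)) (h : genericPoint X ∈ f ⁻¹ᵁ U),
    X.presheaf.germ (f ⁻¹ᵁ U) (genericPoint X) h (f.app U a) ∈ M)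

/-- The generic point of `X` lies in `f⁻¹U` iff the generic point of `Spec_Y(D.ring)` lies in
`fromSpec⁻¹U` (`toSpec` is dominant). [folklore] -/
theorem genericPoint_mem_preimage_iff (D : SubringDatum f) (U : Y.Opens) :
    genericPoint X ∈ f ⁻¹ᵁ U ↔ genericPoint D.spec ∈ D.fromSpec ⁻¹ᵁ U := by
  rw [← D.toSpec_preimage_fromSpec_preimage U]
  change D.toSpec (genericPoint X) ∈ D.fromSpec ⁻¹ᵁ U ↔ _
  rw [genericPoint_eq_of_isDominant]

/-- **`u^* K(Z) ⊆ M`** for `Z = Spec_Y(f_*𝒪_X ∩ M)` and `u = toSpec : X → Z`: a rational function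
on `Z` is a quotient of sections over a chart `fromSpec⁻¹U`, whose pull-backs lie in
`Γ(X, f⁻¹U) ∩ M`. [folklore] -/
theorem functionFieldMap_toSpec_mem :
    ∀ b : (germDatum f M happ).spec.functionField, functionFieldMap (germDatum f M happ).toSpec b ∈ M := by
  set D := germDatum f M happ
  intro b
  obtain ⟨_, ⟨U, hU, rfl⟩, hζU, -⟩ := Y.isBasis_affineOpens.exists_subset_of_mem_open
    (Set.mem_univ (D.fromSpec (genericPoint D.spec))) isOpen_univ
  have hζ : genericPoint D.spec ∈ D.fromSpec ⁻¹ᵁ U := hζU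
  have hξ : genericPoint X ∈ f ⁻¹ᵁ U := (genericPoint_mem_preimage_iff D U).mpr hζ
  haveI : Nonempty (D.fromSpec ⁻¹ᵁ U : D.spec.Opens) := ⟨⟨_, hζ⟩⟩
  haveI := functionField_isFractionRing_of_isAffineOpen D.spec (D.fromSpec ⁻¹ᵁ U)
    (hU.preimage D.fromSpec)
  obtain ⟨z₁, z₂, -, hb⟩ := IsFractionRing.div_surjective (A := Γ(D.spec, D.fromSpec ⁻¹ᵁ U)) b
  have hz : ∀ z : Γ(D.spec, D.fromSpec ⁻¹ᵁ U),
      functionFieldMap D.toSpec (algebraMap _ D.spec.functionField z) ∈ M := by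
    intro z
    have e := germ_appLE_eq_functionFieldMap D.toSpec (D.preimage_le_toSpec_preimage U) hζ hξ z
    change _ = functionFieldMap D.toSpec (algebraMap _ D.spec.functionField z) at e
    rw [← e]
    have hmem : D.toSpec.appLE _ _ (D.preimage_le_toSpec_preimage U) z ∈ D.ring U := by
      rw [← SetLike.mem_coe, ← D.range_toSpec_appLE ⟨U, hU⟩]; exact ⟨z, rfl⟩
    exact hmem hξ
  rw [← hb, map_div₀]
  exact M.div_mem (hz z₁) (hz z₂)

/-- **Quotients of germs of sections of `Γ(X, f⁻¹U) ∩ M` lie in `u^* K(Z)`** (`U` affine): such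
sections are pull-backs of sections of `Z` over the chart `fromSpec⁻¹U`. [folklore] -/
theorem div_mem_range_functionFieldMap_toSpec (U : Y.affineOpens) (hξ : genericPoint X ∈ f ⁻¹ᵁ U.1)
    {s t : Γ(X, f ⁻¹ᵁ U.1)} (hs : s ∈ (germDatum f M happ).ring U.1)
    (ht : t ∈ (germDatum f M happ).ring U.1) :
    X.presheaf.germ _ _ hξ s / X.presheaf.germ _ _ hξ t ∈
      Set.range (functionFieldMap (germDatum f M happ).toSpec) := by
  let D := germDatum f M happ
  have hζ : genericPoint D.spec ∈ D.fromSpec ⁻¹ᵁ U.1 := (genericPoint_mem_preimage_iff D U.1).mp hξ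
  obtain ⟨zs, hzs⟩ := D.exists_toSpec_appLE_eq U hs
  obtain ⟨zt, hzt⟩ := D.exists_toSpec_appLE_eq U ht
  refine ⟨D.spec.presheaf.germ _ _ hζ zs / D.spec.presheaf.germ _ _ hζ zt, ?_⟩
  rw [map_div₀, ← germ_appLE_eq_functionFieldMap D.toSpec (D.preimage_le_toSpec_preimage U.1) hζ hξ,
    ← germ_appLE_eq_functionFieldMap D.toSpec (D.preimage_le_toSpec_preimage U.1) hζ hξ, hzs, hzt]

end FunctionField

end Literature.AlgebraicGeometry.RelativeSpec

end
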